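import Summits.QuantumFields.YangMills.Theorems.UnitScaleTiltProp7CovCurrentPairing
import HarnessLib

/-!
# Route `UnitScaleTilt`, crux K1 «MinimiserStabilityRegPr» (stmt-QuantumFields-19200), route-R E′ growth side, line HKGK-ANALYTIC — ℛ-ROW★ IS A COROLLARY OF J-ROW★:
# at ANY unitary background with plaquettes within `a ≤ 1∕16` of `1`, the curvature-commutator energy `K(φ) = Σ_p|curl_U D_Uφ|²_HS` of a covariant gradient obeys
# `K = ⟨D_Uφ, CURRENT(φ)⟩ + ⟨D_Uφ, CURVATURE⟩` (✓ `Prop7CovCurrentPairing`, exact), the curvature pairing is `≤ a·(3d·M + 4K)` (`M = Σ_b|D_Uφ|²_HS`) with NO value of `φ`,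
# hence a current row `w·CUR(φ) ≤ C_J·K(φ) + C′a²·M(φ)` gives `w·K(φ) ≤ (2C_J + C′a²w∕(2C_J) + 6d·a·w)·M(φ)` — the ℛ-row with `C_ℛ = 2C_J + O(e)` at `w = ℓ²`, `ℓ²a = e`

Cell `ym3-torus`, width seat `ym-ust-19200-w4` (gen 7).  LOCATE v3 addendum (bus 2026-08-29 ≈ 01:4xZ): with ✓p678151 (hKg-K ⟸ ℛ-ROW★ ∧ κ-ROW′) this file makes
the E′ growth side's alignment content ONE row — J-ROW★ («`ℓ²Σ‖[J_U, φ]‖² ≤ C_J·Σ_p‖[hol_p, φ]‖² + C′a²Σ‖D_Uφ‖²`», a criticality row: `J_U = Q_U^*λ`).  THEOREMS ONLY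
(0 `def`, 0 `sorry`); `--supports stmt-QuantumFields-19200`, count-neutral.  YM₃ on T³ is a ladder rung (R3), not the Clay problem; nothing here claims J-ROW★, hKg-K, S3, E′,
a stub, the crux, d = 4 or the mass gap.

LETTERS (`B9Eq39Adjoint`: `R covD covDstar curl plaqU` on the torus `torusT P i`, unitary units-valued background `U : Fin P.d → Site P i → (M_N(ℂ))ˣ`; Hilbert–Schmidt sizes
`Σ_jk‖X_jk‖²` as in ✓ `Prop7TracePairing`).  For a site field `φ`:
* `K(φ) := Σ_x Σ_μ Σ_ν [μ < ν]·Σ_jk‖(curl_U D_Uφ)_{μν}(x)_jk‖²`, `M(φ) := Σ_x Σ_μ Σ_jk‖(D_{U,μ}φ)(x)_jk‖²`,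
* `CUR(φ) := Σ_x Σ_μ Σ_jk‖(Σ_ν CURRENT_{νμ}(x))_jk‖²` with `CURRENT_{νμ}(x)` the current summand of ✓ `sum_re_trace_curl_mul_curl_covD_eq_current_add_curv` VERBATIM
  (transported difference of the plaquette variables `U(∂p_{νμ}(x − e_ν))`, `U(∂p_{νμ}(x))` acting on the transported value of `φ`).

WHAT IS PROVED (ns `…Theorems.Prop7RRowOfJRow`).
* §1 ★ `covDstar_transported_eq` — the curvature term's inner letter, EXACTLY: `D^*_ν g_ν(x) = R(U_μ(x))(R(Λ)φ(x+e_μ) − φ(x+e_μ)) − R(U_μ(x))(D_νφ)(x+e_μ)`, `Λ` a transported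
  inverse plaquette; ★★ `sum_norm_sq_covDstar_transported_le` — `|D^*_νg_ν(x)|²_HS ≤ 2|curl_U D_Uφ(p_{νμ}(x − e_ν))|²_HS + 2|(D_νφ)(x + e_μ)|²_HS` (value-free).
* §2 ★★ `curv_pairing_le` — `Σ_xΣ_μΣ_ν |Re tr((D_μφ(x))ᴴ·CURVATURE_{νμ}(x))| ≤ a·(3d·M(φ) + 4·K(φ))`.
* §3 ★★ `K_eq_current_add_curv_pairing` — the identity read at `B := D_Uφ`: `K(φ) = Σ_xΣ_μ Re tr((D_μφ(x))ᴴ·Σ_ν(CURRENT + CURVATURE))`.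
* §4 ★★★ `RRow_of_JRow` — `w·CUR(φ) ≤ C_J·K(φ) + C′·a²·M(φ)`, `0 < C_J`, `0 < w`, `0 ≤ a`, `16a ≤ 1` ⟹ `w·K(φ) ≤ (2C_J + C′a²w∕(2C_J) + 6d·a·w)·M(φ)`.
HONEST SCOPE.  Exact lattice algebra + weighted AM–GM; the current row is DISPLAYED (its inhabitant at an R2-critical background — `J_U = Q_U^*λ` + Bernstein one order up,
✓p682296/✓p683429 flat — is open, LOCATE v3 §2); the T³/E′ op-norm reading (`N = 2`, `U := unitsField (toUField W)`, HS = 2·op² on 𝔰𝔲(2)) is one line for the consumer.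

References: T. Bałaban, CMP 99 (1985) 389–434 [Balaban1985BackgroundPropagators] ((3.3)–(3.4) pp.390–391, (3.8)–(3.9) p.392); CMP 99 (1985) 75–102 [Balaban1985RegularSpaces]
((1.2) p.76, (1.9) p.77); CMP 102 (1985) 277–309 [Balaban1985Variational] ((135) p.298, Prop. 7 p.299).
-/

set_option autoImplicit false

noncomputable section

open scoped BigOperators Matrix.Norms.L2Operator Matrix

namespace Summit.QuantumFields.YangMills.Theorems.Prop7RRowOfJRow

open Literature.MathematicalPhysics.QuantumFieldTheory.Balaban1983to89
open B9Eq39Adjoint (R R_def R_add R_sub R_neg R_inv_R R_R_inv covD covDstar curl plaqU curl_swap curl_self)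
open B9TorusCalculus (torusT torusT_apply torusT_symm_apply torusT_comm)
open Summit.QuantumFields.YangMills.Theorems.Prop7CovariantCurlOfGrad (curl_covD_eq_conj_plaqU)
open Summit.QuantumFields.YangMills.Theorems.Prop7CovariantCoercivity (re_trace_conjTranspose_mul_self two_mul_abs_re_trace_le sum_norm_sq_add_le sum_norm_sq_R inv_mem_unitary)
open Summit.QuantumFields.YangMills.Theorems.Prop7CovCurrentPairing (sum_re_trace_curl_mul_curl_covD_eq_current_add_curv abs_re_trace_conjTranspose_mul_conj_sub_le)

variable {P : Params} {i : ℕ} {N : ℕ} (U : Fin P.d → Site P i → (Matrix (Fin N) (Fin N) ℂ)ˣ)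

/-! ## §1 The curvature term's inner letter, exactly, and its value-free size -/

/-- on the torus, `(x − e_ν) + e_ν = x`. [folklore] -/
theorem shift_unshift (ν : Fin P.d) (x : Site P i) : (x.unshift ν).shift ν = x :=
  (torusT P i ν).apply_symm_apply x

/-- on the torus, `(x − e_ν) + e_μ + e_ν = x + e_μ`. [folklore] -/
theorem shift_shift_unshift (μ ν : Fin P.d) (x : Site P i) : ((x.unshift ν).shift μ).shift ν = x.shift μ := by
  show torusT P i ν (torusT P i μ ((torusT P i ν).symm x)) = torusT P i μ x
  rw [torusT_comm, Equiv.apply_symm_apply]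

/-- ★ **THE INNER LETTER OF THE CURVATURE TERM, EXACTLY**: with `g_ν(y) = R(U_μ(y)U_ν(y+e_μ))φ(y+e_μ+e_ν)`,
`(D^*_ν g_ν)(x) = R(U_μ(x))·(R(Λ)φ(x+e_μ) − φ(x+e_μ)) − R(U_μ(x))·(D_νφ)(x+e_μ)`, `Λ = U_μ(x)⁻¹·U_ν(x−e_ν)⁻¹U_μ(x−e_ν)U_ν(x−e_ν+e_μ)` (a transported inverse
plaquette). [cite: Balaban1985BackgroundPropagators, (3.8) p.392] -/
theorem covDstar_transported_eq (φ : Site P i → Matrix (Fin N) (Fin N) ℂ) (μ ν : Fin P.d) (x : Site P i) :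
    covDstar (torusT P i) U ν (fun y => R (U μ y * U ν (y.shift μ)) (φ ((y.shift μ).shift ν))) x
      = R (U μ x) (R ((U μ x)⁻¹ * ((U ν (x.unshift ν))⁻¹ * (U μ (x.unshift ν) * U ν ((x.unshift ν).shift μ)))) (φ (x.shift μ)) - φ (x.shift μ))
        - R (U μ x) (covD (torusT P i) U ν φ (x.shift μ)) := by
  simp only [covDstar, covD, torusT_apply, torusT_symm_apply, shift_shift_unshift, R_sub]
  simp only [← B9Eq39Adjoint.R_mul, mul_inv_cancel_left]
  abel

/-- the loop identity behind the curl reading: `T₀·Λ⁻¹ = U(∂p_{νμ}(x−e_ν))·T₀`, `T₀ = U_μ(x−e_ν)U_ν(x−e_ν+e_μ)`. [folklore] -/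
theorem loop_eq (μ ν : Fin P.d) (x : Site P i) :
    (U μ (x.unshift ν) * U ν ((x.unshift ν).shift μ))
        * ((U μ x)⁻¹ * ((U ν (x.unshift ν))⁻¹ * (U μ (x.unshift ν) * U ν ((x.unshift ν).shift μ))))⁻¹
      = plaqU (torusT P i) U ν μ (x.unshift ν) * (U μ (x.unshift ν) * U ν ((x.unshift ν).shift μ)) := by
  simp only [plaqU, torusT_apply, shift_unshift, mul_inv_rev, inv_inv, mul_assoc, mul_inv_cancel_left, inv_mul_cancel_left, inv_mul_cancel, mul_one]

/-- ★★ **VALUE-FREE SIZE OF THE CURVATURE TERM'S INNER LETTER**: `|D^*_νg_ν(x)|²_HS ≤ 2·|curl_U D_Uφ(p_{νμ}(x−e_ν))|²_HS + 2·|(D_νφ)(x+e_μ)|²_HS` — a curvature commutator and a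
covariant difference of `φ`, no value of `φ`. [cite: Balaban1985BackgroundPropagators, (3.4) p.391, (3.8) p.392] -/
theorem sum_norm_sq_covDstar_transported_le (hU : ∀ (ν : Fin P.d) (x : Site P i), (U ν x : Matrix (Fin N) (Fin N) ℂ) ∈ unitary (Matrix (Fin N) (Fin N) ℂ))
    (φ : Site P i → Matrix (Fin N) (Fin N) ℂ) (μ ν : Fin P.d) (x : Site P i) :
    ∑ j : Fin N, ∑ k : Fin N, ‖(covDstar (torusT P i) U ν (fun y => R (U μ y * U ν (y.shift μ)) (φ ((y.shift μ).shift ν))) x) j k‖ ^ 2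
      ≤ 2 * ∑ j : Fin N, ∑ k : Fin N, ‖(curl (torusT P i) U (fun κ => covD (torusT P i) U κ φ) ν μ (x.unshift ν)) j k‖ ^ 2
        + 2 * ∑ j : Fin N, ∑ k : Fin N, ‖(covD (torusT P i) U ν φ (x.shift μ)) j k‖ ^ 2 := by
  set T₀ : (Matrix (Fin N) (Fin N) ℂ)ˣ := U μ (x.unshift ν) * U ν ((x.unshift ν).shift μ) with hT₀
  set Λ : (Matrix (Fin N) (Fin N) ℂ)ˣ := (U μ x)⁻¹ * ((U ν (x.unshift ν))⁻¹ * T₀) with hΛ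
  set X : Matrix (Fin N) (Fin N) ℂ := φ (x.shift μ) with hX
  have hUμ : (U μ x : Matrix (Fin N) (Fin N) ℂ) ∈ unitary (Matrix (Fin N) (Fin N) ℂ) := hU μ x
  have hT₀u : (T₀ : Matrix (Fin N) (Fin N) ℂ) ∈ unitary (Matrix (Fin N) (Fin N) ℂ) := by
    rw [hT₀, Units.val_mul]; exact mul_mem (hU _ _) (hU _ _)
  have hΛu : (Λ : Matrix (Fin N) (Fin N) ℂ) ∈ unitary (Matrix (Fin N) (Fin N) ℂ) := by
    rw [hΛ, Units.val_mul, Units.val_mul]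
    exact mul_mem (inv_mem_unitary (hU _ _)) (mul_mem (inv_mem_unitary (hU _ _)) hT₀u)
  have hΛiu : ((Λ⁻¹ : (Matrix (Fin N) (Fin N) ℂ)ˣ) : Matrix (Fin N) (Fin N) ℂ) ∈ unitary (Matrix (Fin N) (Fin N) ℂ) := inv_mem_unitary hΛu
  -- the exact decomposition
  have hZ := covDstar_transported_eq U φ μ ν x
  rw [← hT₀, ← hΛ, ← hX] at hZ
  rw [hZ, sub_eq_add_neg, ← R_neg]
  refine (sum_norm_sq_add_le _ _).trans ?_
  rw [sum_norm_sq_R hUμ, sum_norm_sq_R hUμ]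
  have h2 : ∑ j : Fin N, ∑ k : Fin N, ‖(-covD (torusT P i) U ν φ (x.shift μ)) j k‖ ^ 2
      = ∑ j : Fin N, ∑ k : Fin N, ‖(covD (torusT P i) U ν φ (x.shift μ)) j k‖ ^ 2 := by
    simp only [Matrix.neg_apply, norm_neg]
  rw [h2]
  -- the first summand is the curl at `p_{νμ}(x − e_ν)`, read through the isometries `R(T₀)`, `R(Λ⁻¹)`
  have hTΛ : T₀ * Λ⁻¹ = plaqU (torusT P i) U ν μ (x.unshift ν) * T₀ := by
    rw [hΛ, hT₀]; exact loop_eq U μ ν x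
  have hc0 := curl_covD_eq_conj_plaqU (torusT P i) U φ ν μ (x.unshift ν) (torusT_comm μ ν _)
  simp only [torusT_apply, shift_shift_unshift] at hc0
  rw [← hT₀, ← hX] at hc0
  have hcurl : curl (torusT P i) U (fun κ => covD (torusT P i) U κ φ) ν μ (x.unshift ν) = R T₀ (R Λ⁻¹ X - X) := by
    rw [hc0, R_sub, ← B9Eq39Adjoint.R_mul, ← B9Eq39Adjoint.R_mul, hTΛ]
  have h1 : ∑ j : Fin N, ∑ k : Fin N, ‖(R Λ X - X) j k‖ ^ 2
      = ∑ j : Fin N, ∑ k : Fin N, ‖(curl (torusT P i) U (fun κ => covD (torusT P i) U κ φ) ν μ (x.unshift ν)) j k‖ ^ 2 := by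
    rw [hcurl, sum_norm_sq_R hT₀u, ← sum_norm_sq_R hΛiu (R Λ X - X), R_sub, R_inv_R]
    have e : X - R Λ⁻¹ X = -(R Λ⁻¹ X - X) := by abel
    rw [e]
    simp only [Matrix.neg_apply, norm_neg]
  rw [h1]

/-! ## §2 The curvature pairing is `O(a)` in the currencies `M`, `K` -/

/-- ★★ **THE CURVATURE PAIRING BOUND**: if every plaquette variable is within `a` of `1` (`0 ≤ a`), then
`Σ_xΣ_μΣ_ν |Re tr((D_μφ(x))ᴴ·(R(U(∂p_{νμ}(x)))Z_{νμ}(x) − Z_{νμ}(x)))| ≤ a·(3d·M(φ) + 4·K(φ))`, `Z_{νμ}(x) = D^*_νg_ν(x)` the identity's inner letter.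
[cite: Balaban1985Variational, (135) p.298; Balaban1985BackgroundPropagators, (3.9) p.392] -/
theorem curv_pairing_le [NeZero N] (hU : ∀ (ν : Fin P.d) (x : Site P i), (U ν x : Matrix (Fin N) (Fin N) ℂ) ∈ unitary (Matrix (Fin N) (Fin N) ℂ))
    {a : ℝ} (ha0 : 0 ≤ a) (ha : ∀ (μ ν : Fin P.d) (x : Site P i), ‖(plaqU (torusT P i) U μ ν x : Matrix (Fin N) (Fin N) ℂ) - 1‖ ≤ a)
    (φ : Site P i → Matrix (Fin N) (Fin N) ℂ) :
    ∑ x : Site P i, ∑ μ : Fin P.d, ∑ ν : Fin P.d,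
        |(((covD (torusT P i) U μ φ x)ᴴ *
            (R (plaqU (torusT P i) U ν μ x) (covDstar (torusT P i) U ν (fun y => R (U μ y * U ν (y.shift μ)) (φ ((y.shift μ).shift ν))) x)
                - covDstar (torusT P i) U ν (fun y => R (U μ y * U ν (y.shift μ)) (φ ((y.shift μ).shift ν))) x)).trace).re|
      ≤ a * (3 * P.d * (∑ x : Site P i, ∑ μ : Fin P.d, ∑ j : Fin N, ∑ k : Fin N, ‖(covD (torusT P i) U μ φ x) j k‖ ^ 2)
          + 4 * ∑ x : Site P i, ∑ μ : Fin P.d, ∑ ν : Fin P.d, (if μ < ν then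
        ∑ j : Fin N, ∑ k : Fin N, ‖(curl (torusT P i) U (fun κ => covD (torusT P i) U κ φ) μ ν x) j k‖ ^ 2 else 0)) := by
  -- letters
  set Dn : Fin P.d → Site P i → ℝ := fun μ x => ∑ j : Fin N, ∑ k : Fin N, ‖(covD (torusT P i) U μ φ x) j k‖ ^ 2 with hDn
  set Cn : Fin P.d → Fin P.d → Site P i → ℝ := fun μ ν x =>
    ∑ j : Fin N, ∑ k : Fin N, ‖(curl (torusT P i) U (fun κ => covD (torusT P i) U κ φ) μ ν x) j k‖ ^ 2 with hCn
  -- pointwise: `|pairing| ≤ a·Dn μ x + 2a·Cn ν μ (x − e_ν) + 2a·Dn ν (x + e_μ)`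
  have hpt : ∀ (x : Site P i) (μ ν : Fin P.d),
      |(((covD (torusT P i) U μ φ x)ᴴ *
            (R (plaqU (torusT P i) U ν μ x) (covDstar (torusT P i) U ν (fun y => R (U μ y * U ν (y.shift μ)) (φ ((y.shift μ).shift ν))) x)
                - covDstar (torusT P i) U ν (fun y => R (U μ y * U ν (y.shift μ)) (φ ((y.shift μ).shift ν))) x)).trace).re|
        ≤ a * Dn μ x + 2 * a * Cn ν μ (x.unshift ν) + 2 * a * Dn ν (x.shift μ) := by
    intro x μ ν
    refine (abs_re_trace_conjTranspose_mul_conj_sub_le U hU ν μ x (ha ν μ x) _ _).trans ?_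
    have h := mul_le_mul_of_nonneg_left (sum_norm_sq_covDstar_transported_le U hU φ μ ν x) ha0
    simp only [hDn, hCn]
    nlinarith [h]
  -- sum the three pieces
  have hS := Finset.sum_le_sum fun x (_ : x ∈ Finset.univ) =>
    Finset.sum_le_sum fun μ (_ : μ ∈ Finset.univ) => Finset.sum_le_sum fun ν (_ : ν ∈ Finset.univ) => hpt x μ ν
  refine hS.trans (le_of_eq ?_)
  simp only [Finset.sum_add_distrib, ← Finset.mul_sum]
  -- (i) the ν-constant piece
  have e1 : ∑ x : Site P i, ∑ μ : Fin P.d, ∑ _ν : Fin P.d, Dn μ x = P.d * ∑ x : Site P i, ∑ μ : Fin P.d, Dn μ x := by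
    rw [Finset.mul_sum]
    refine Finset.sum_congr rfl fun x _ => ?_
    rw [Finset.mul_sum]
    refine Finset.sum_congr rfl fun μ _ => ?_
    rw [Finset.sum_const, Finset.card_univ, Fintype.card_fin, nsmul_eq_mul]
  -- (ii) reindex the shifted sums over the torus
  have e2 : ∑ x : Site P i, ∑ μ : Fin P.d, ∑ ν : Fin P.d, Cn ν μ (x.unshift ν)
      = ∑ x : Site P i, ∑ μ : Fin P.d, ∑ ν : Fin P.d, Cn ν μ x := by
    rw [Finset.sum_comm]
    conv_rhs => rw [Finset.sum_comm]
    refine Finset.sum_congr rfl fun μ _ => ?_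
    rw [Finset.sum_comm]
    conv_rhs => rw [Finset.sum_comm]
    refine Finset.sum_congr rfl fun ν _ => ?_
    exact Fintype.sum_equiv (torusT P i ν).symm _ _ fun x => rfl
  have e3 : ∑ x : Site P i, ∑ μ : Fin P.d, ∑ ν : Fin P.d, Dn ν (x.shift μ)
      = P.d * ∑ x : Site P i, ∑ μ : Fin P.d, Dn μ x := by
    rw [Finset.sum_comm]
    have : ∀ μ : Fin P.d, ∑ x : Site P i, ∑ ν : Fin P.d, Dn ν (x.shift μ) = ∑ x : Site P i, ∑ ν : Fin P.d, Dn ν x := fun μ =>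
      Fintype.sum_equiv (torusT P i μ) _ _ fun x => rfl
    simp only [this, Finset.sum_const, Finset.card_univ, Fintype.card_fin, nsmul_eq_mul]
  -- (iii) the full curl sum is twice the ordered one
  have hsw : ∀ (x : Site P i) (μ ν : Fin P.d), Cn ν μ x = Cn μ ν x := fun x μ ν => by
    simp only [hCn, curl_swap (torusT P i) U (fun κ => covD (torusT P i) U κ φ) μ ν x, Matrix.neg_apply, norm_neg]
  have hdiag : ∀ (x : Site P i) (μ : Fin P.d), Cn μ μ x = 0 := fun x μ => by simp [hCn]
  have e4 : ∑ x : Site P i, ∑ μ : Fin P.d, ∑ ν : Fin P.d, Cn ν μ x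
      = 2 * ∑ x : Site P i, ∑ μ : Fin P.d, ∑ ν : Fin P.d, (if μ < ν then Cn μ ν x else 0) := by
    rw [Finset.mul_sum]
    refine Finset.sum_congr rfl fun x _ => ?_
    have hsplit : ∀ μ ν : Fin P.d, Cn ν μ x = (if μ < ν then Cn μ ν x else 0) + (if ν < μ then Cn ν μ x else 0) := by
      intro μ ν
      rcases lt_trichotomy μ ν with h | h | h
      · rw [if_pos h, if_neg (not_lt.mpr h.le), add_zero, hsw]
      · subst h; rw [if_neg (lt_irrefl _), add_zero, hdiag]
      · rw [if_neg (not_lt.mpr h.le), if_pos h, zero_add]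
    have hswap : ∑ μ : Fin P.d, ∑ ν : Fin P.d, (if ν < μ then Cn ν μ x else 0)
        = ∑ μ : Fin P.d, ∑ ν : Fin P.d, (if μ < ν then Cn μ ν x else 0) := by
      rw [Finset.sum_comm]
    rw [Finset.sum_congr rfl fun μ _ => Finset.sum_congr rfl fun ν _ => hsplit μ ν]
    simp only [Finset.sum_add_distrib]
    rw [hswap, two_mul]
  rw [e1, e2, e3, e4]
  ring

/-! ## §3 The identity read at `B := D_Uφ` -/

/-- ★★ **`K(φ)` IS THE CURRENT PAIRING PLUS THE CURVATURE PAIRING** — ✓ `sum_re_trace_curl_mul_curl_covD_eq_current_add_curv` at `B := D_Uφ`, with `Re tr(XᴴX) = Σ|X_jk|²`.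
[cite: Balaban1985BackgroundPropagators, (3.3)-(3.4) pp.390-391, (3.9) p.392] -/
theorem K_eq_current_add_curv_pairing (hU : ∀ (ν : Fin P.d) (x : Site P i), (U ν x : Matrix (Fin N) (Fin N) ℂ) ∈ unitary (Matrix (Fin N) (Fin N) ℂ))
    (φ : Site P i → Matrix (Fin N) (Fin N) ℂ) :
    ∑ x : Site P i, ∑ μ : Fin P.d, ∑ ν : Fin P.d, (if μ < ν then
        ∑ j : Fin N, ∑ k : Fin N, ‖(curl (torusT P i) U (fun κ => covD (torusT P i) U κ φ) μ ν x) j k‖ ^ 2 else 0)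
      = ∑ x : Site P i, ∑ μ : Fin P.d, (((covD (torusT P i) U μ φ x)ᴴ *
          ∑ ν : Fin P.d,
            ((R ((U ν (x.unshift ν))⁻¹ * plaqU (torusT P i) U ν μ (x.unshift ν) * U ν (x.unshift ν))
                  (R (U ν (x.unshift ν))⁻¹ (R (U μ (x.unshift ν) * U ν ((x.unshift ν).shift μ)) (φ (((x.unshift ν).shift μ).shift ν))))
              - R (plaqU (torusT P i) U ν μ x)
                  (R (U ν (x.unshift ν))⁻¹ (R (U μ (x.unshift ν) * U ν ((x.unshift ν).shift μ)) (φ (((x.unshift ν).shift μ).shift ν)))))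
            + (R (plaqU (torusT P i) U ν μ x) (covDstar (torusT P i) U ν (fun y => R (U μ y * U ν (y.shift μ)) (φ ((y.shift μ).shift ν))) x)
                - covDstar (torusT P i) U ν (fun y => R (U μ y * U ν (y.shift μ)) (φ ((y.shift μ).shift ν))) x))).trace).re := by
  rw [← sum_re_trace_curl_mul_curl_covD_eq_current_add_curv U hU (fun κ => covD (torusT P i) U κ φ) φ]
  refine Finset.sum_congr rfl fun x _ => Finset.sum_congr rfl fun μ _ => Finset.sum_congr rfl fun ν _ => ?_
  split_ifs
  · rw [re_trace_conjTranspose_mul_self]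
  · rfl

/-! ## §4 ★★★ ℛ-ROW★ from J-ROW★ -/

/-- ★★★ **ℛ-ROW★ IS A COROLLARY OF J-ROW★.**  Unitary background with `‖U(∂p) − 1‖ ≤ a`, `0 ≤ a`, `16a ≤ 1`; site field `φ`; reals `0 < C_J`, `C′`, `0 < w`.  IF the
current row `w·CUR(φ) ≤ C_J·K(φ) + C′·a²·M(φ)` holds (CUR = the HS size of the ν-summed CURRENT terms of ✓ `sum_re_trace_curl_mul_curl_covD_eq_current_add_curv`, verbatim),
THEN `w·K(φ) ≤ (2C_J + C′a²w∕(2C_J) + 6d·a·w)·M(φ)`.  At `w = ℓ²`, `a = eℓ⁻²`: `C_ℛ = 2C_J + C′e²∕(2C_Jℓ²) + 6d·e`.  Proof: §3, weighted AM–GM with `θ = 2C_J∕w` on the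
current pairing, §2 on the curvature pairing, absorb `K∕4 + 4aK ≤ K∕2`. [cite: Balaban1985BackgroundPropagators, (3.9) p.392; Balaban1985Variational, (135) p.298, Prop. 7 p.299] -/
theorem RRow_of_JRow [NeZero N] (hU : ∀ (ν : Fin P.d) (x : Site P i), (U ν x : Matrix (Fin N) (Fin N) ℂ) ∈ unitary (Matrix (Fin N) (Fin N) ℂ))
    {a : ℝ} (ha0 : 0 ≤ a) (ha : ∀ (μ ν : Fin P.d) (x : Site P i), ‖(plaqU (torusT P i) U μ ν x : Matrix (Fin N) (Fin N) ℂ) - 1‖ ≤ a) (ha16 : 16 * a ≤ 1)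
    (φ : Site P i → Matrix (Fin N) (Fin N) ℂ) {C_J C' w : ℝ} (hCJ : 0 < C_J) (hw : 0 < w)
    (hJ : w * ∑ x : Site P i, ∑ μ : Fin P.d, ∑ j : Fin N, ∑ k : Fin N,
        ‖(∑ ν : Fin P.d,
            (R ((U ν (x.unshift ν))⁻¹ * plaqU (torusT P i) U ν μ (x.unshift ν) * U ν (x.unshift ν))
                  (R (U ν (x.unshift ν))⁻¹ (R (U μ (x.unshift ν) * U ν ((x.unshift ν).shift μ)) (φ (((x.unshift ν).shift μ).shift ν))))
              - R (plaqU (torusT P i) U ν μ x)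
                  (R (U ν (x.unshift ν))⁻¹ (R (U μ (x.unshift ν) * U ν ((x.unshift ν).shift μ)) (φ (((x.unshift ν).shift μ).shift ν)))))) j k‖ ^ 2
      ≤ C_J * ∑ x : Site P i, ∑ μ : Fin P.d, ∑ ν : Fin P.d, (if μ < ν then
        ∑ j : Fin N, ∑ k : Fin N, ‖(curl (torusT P i) U (fun κ => covD (torusT P i) U κ φ) μ ν x) j k‖ ^ 2 else 0)
        + C' * a ^ 2 * ∑ x : Site P i, ∑ μ : Fin P.d, ∑ j : Fin N, ∑ k : Fin N, ‖(covD (torusT P i) U μ φ x) j k‖ ^ 2) :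
    w * ∑ x : Site P i, ∑ μ : Fin P.d, ∑ ν : Fin P.d, (if μ < ν then
        ∑ j : Fin N, ∑ k : Fin N, ‖(curl (torusT P i) U (fun κ => covD (torusT P i) U κ φ) μ ν x) j k‖ ^ 2 else 0)
      ≤ (2 * C_J + C' * a ^ 2 * w / (2 * C_J) + 6 * P.d * a * w)
          * ∑ x : Site P i, ∑ μ : Fin P.d, ∑ j : Fin N, ∑ k : Fin N, ‖(covD (torusT P i) U μ φ x) j k‖ ^ 2 := by
  -- §2 and §3 (before the letters are abbreviated)
  have hcp := curv_pairing_le U hU ha0 ha φ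
  have hid0 := K_eq_current_add_curv_pairing U hU φ
  -- letters (closed terms: `set` abbreviates them in `hJ`, `hcp`, `hid0` too)
  set K : ℝ := ∑ x : Site P i, ∑ μ : Fin P.d, ∑ ν : Fin P.d, (if μ < ν then
        ∑ j : Fin N, ∑ k : Fin N, ‖(curl (torusT P i) U (fun κ => covD (torusT P i) U κ φ) μ ν x) j k‖ ^ 2 else 0) with hK
  set M : ℝ := ∑ x : Site P i, ∑ μ : Fin P.d, ∑ j : Fin N, ∑ k : Fin N, ‖(covD (torusT P i) U μ φ x) j k‖ ^ 2 with hM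
  set CUR : ℝ := ∑ x : Site P i, ∑ μ : Fin P.d, ∑ j : Fin N, ∑ k : Fin N,
        ‖(∑ ν : Fin P.d,
            (R ((U ν (x.unshift ν))⁻¹ * plaqU (torusT P i) U ν μ (x.unshift ν) * U ν (x.unshift ν))
                  (R (U ν (x.unshift ν))⁻¹ (R (U μ (x.unshift ν) * U ν ((x.unshift ν).shift μ)) (φ (((x.unshift ν).shift μ).shift ν))))
              - R (plaqU (torusT P i) U ν μ x)
                  (R (U ν (x.unshift ν))⁻¹ (R (U μ (x.unshift ν) * U ν ((x.unshift ν).shift μ)) (φ (((x.unshift ν).shift μ).shift ν)))))) j k‖ ^ 2 with hCUR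
  have hK0 : 0 ≤ K := by
    rw [hK]; exact Finset.sum_nonneg fun _ _ => Finset.sum_nonneg fun _ _ => Finset.sum_nonneg fun _ _ => by
      split_ifs
      · exact Finset.sum_nonneg fun _ _ => Finset.sum_nonneg fun _ _ => sq_nonneg _
      · exact le_rfl
  have hM0 : 0 ≤ M := by
    rw [hM]; exact Finset.sum_nonneg fun _ _ => Finset.sum_nonneg fun _ _ => Finset.sum_nonneg fun _ _ => Finset.sum_nonneg fun _ _ => sq_nonneg _
  have hCUR0 : 0 ≤ CUR := by
    rw [hCUR]; exact Finset.sum_nonneg fun _ _ => Finset.sum_nonneg fun _ _ => Finset.sum_nonneg fun _ _ => Finset.sum_nonneg fun _ _ => sq_nonneg _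
  clear_value K M CUR
  -- §3: `K = Σ Re tr((D_μφ)ᴴ·CURRENT) + Σ Re tr((D_μφ)ᴴ·CURVATURE)`
  have hid : K = ∑ x : Site P i, ∑ μ : Fin P.d, (((covD (torusT P i) U μ φ x)ᴴ * ∑ ν : Fin P.d,
            (R ((U ν (x.unshift ν))⁻¹ * plaqU (torusT P i) U ν μ (x.unshift ν) * U ν (x.unshift ν))
                  (R (U ν (x.unshift ν))⁻¹ (R (U μ (x.unshift ν) * U ν ((x.unshift ν).shift μ)) (φ (((x.unshift ν).shift μ).shift ν))))
              - R (plaqU (torusT P i) U ν μ x)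
                  (R (U ν (x.unshift ν))⁻¹ (R (U μ (x.unshift ν) * U ν ((x.unshift ν).shift μ)) (φ (((x.unshift ν).shift μ).shift ν)))))).trace).re
      + ∑ x : Site P i, ∑ μ : Fin P.d, ∑ ν : Fin P.d, (((covD (torusT P i) U μ φ x)ᴴ *
          (R (plaqU (torusT P i) U ν μ x) (covDstar (torusT P i) U ν (fun y => R (U μ y * U ν (y.shift μ)) (φ ((y.shift μ).shift ν))) x)
                - covDstar (torusT P i) U ν (fun y => R (U μ y * U ν (y.shift μ)) (φ ((y.shift μ).shift ν))) x)).trace).re := by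
    rw [hid0, ← Finset.sum_add_distrib]
    refine Finset.sum_congr rfl fun x _ => ?_
    rw [← Finset.sum_add_distrib]
    refine Finset.sum_congr rfl fun μ _ => ?_
    rw [Finset.sum_add_distrib, Matrix.mul_add, Matrix.trace_add, Complex.add_re]
    congr 1
    rw [Finset.mul_sum, Matrix.trace_sum, Complex.re_sum]
  -- the current pairing by weighted AM–GM, `θ = 2C_J∕w`
  set θ : ℝ := 2 * C_J / w with hθ
  have hθ0 : 0 < θ := by rw [hθ]; positivity
  clear_value θ
  have hcurAM : ∑ x : Site P i, ∑ μ : Fin P.d, (((covD (torusT P i) U μ φ x)ᴴ * ∑ ν : Fin P.d,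
            (R ((U ν (x.unshift ν))⁻¹ * plaqU (torusT P i) U ν μ (x.unshift ν) * U ν (x.unshift ν))
                  (R (U ν (x.unshift ν))⁻¹ (R (U μ (x.unshift ν) * U ν ((x.unshift ν).shift μ)) (φ (((x.unshift ν).shift μ).shift ν))))
              - R (plaqU (torusT P i) U ν μ x)
                  (R (U ν (x.unshift ν))⁻¹ (R (U μ (x.unshift ν) * U ν ((x.unshift ν).shift μ)) (φ (((x.unshift ν).shift μ).shift ν)))))).trace).re ≤ θ / 2 * M + θ⁻¹ / 2 * CUR := by
    have hpt : ∀ (x : Site P i) (μ : Fin P.d), (((covD (torusT P i) U μ φ x)ᴴ * ∑ ν : Fin P.d,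
            (R ((U ν (x.unshift ν))⁻¹ * plaqU (torusT P i) U ν μ (x.unshift ν) * U ν (x.unshift ν))
                  (R (U ν (x.unshift ν))⁻¹ (R (U μ (x.unshift ν) * U ν ((x.unshift ν).shift μ)) (φ (((x.unshift ν).shift μ).shift ν))))
              - R (plaqU (torusT P i) U ν μ x)
                  (R (U ν (x.unshift ν))⁻¹ (R (U μ (x.unshift ν) * U ν ((x.unshift ν).shift μ)) (φ (((x.unshift ν).shift μ).shift ν)))))).trace).re
        ≤ θ / 2 * ∑ j : Fin N, ∑ k : Fin N, ‖(covD (torusT P i) U μ φ x) j k‖ ^ 2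
          + θ⁻¹ / 2 * ∑ j : Fin N, ∑ k : Fin N, ‖(∑ ν : Fin P.d,
            (R ((U ν (x.unshift ν))⁻¹ * plaqU (torusT P i) U ν μ (x.unshift ν) * U ν (x.unshift ν))
                  (R (U ν (x.unshift ν))⁻¹ (R (U μ (x.unshift ν) * U ν ((x.unshift ν).shift μ)) (φ (((x.unshift ν).shift μ).shift ν))))
              - R (plaqU (torusT P i) U ν μ x)
                  (R (U ν (x.unshift ν))⁻¹ (R (U μ (x.unshift ν) * U ν ((x.unshift ν).shift μ)) (φ (((x.unshift ν).shift μ).shift ν)))))) j k‖ ^ 2 := by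
      intro x μ
      have h := two_mul_abs_re_trace_le hθ0 (covD (torusT P i) U μ φ x) (∑ ν : Fin P.d,
            (R ((U ν (x.unshift ν))⁻¹ * plaqU (torusT P i) U ν μ (x.unshift ν) * U ν (x.unshift ν))
                  (R (U ν (x.unshift ν))⁻¹ (R (U μ (x.unshift ν) * U ν ((x.unshift ν).shift μ)) (φ (((x.unshift ν).shift μ).shift ν))))
              - R (plaqU (torusT P i) U ν μ x)
                  (R (U ν (x.unshift ν))⁻¹ (R (U μ (x.unshift ν) * U ν ((x.unshift ν).shift μ)) (φ (((x.unshift ν).shift μ).shift ν))))))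
      have := le_abs_self (((covD (torusT P i) U μ φ x)ᴴ * ∑ ν : Fin P.d,
            (R ((U ν (x.unshift ν))⁻¹ * plaqU (torusT P i) U ν μ (x.unshift ν) * U ν (x.unshift ν))
                  (R (U ν (x.unshift ν))⁻¹ (R (U μ (x.unshift ν) * U ν ((x.unshift ν).shift μ)) (φ (((x.unshift ν).shift μ).shift ν))))
              - R (plaqU (torusT P i) U ν μ x)
                  (R (U ν (x.unshift ν))⁻¹ (R (U μ (x.unshift ν) * U ν ((x.unshift ν).shift μ)) (φ (((x.unshift ν).shift μ).shift ν)))))).trace).re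
      linarith
    refine (Finset.sum_le_sum fun x _ => Finset.sum_le_sum fun μ _ => hpt x μ).trans (le_of_eq ?_)
    rw [hM, hCUR, Finset.mul_sum, Finset.mul_sum, ← Finset.sum_add_distrib]
    refine Finset.sum_congr rfl fun x _ => ?_
    rw [Finset.mul_sum, Finset.mul_sum, ← Finset.sum_add_distrib]
  -- the curvature pairing by §2
  have hcvb : ∑ x : Site P i, ∑ μ : Fin P.d, ∑ ν : Fin P.d, (((covD (torusT P i) U μ φ x)ᴴ *
          (R (plaqU (torusT P i) U ν μ x) (covDstar (torusT P i) U ν (fun y => R (U μ y * U ν (y.shift μ)) (φ ((y.shift μ).shift ν))) x)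
                - covDstar (torusT P i) U ν (fun y => R (U μ y * U ν (y.shift μ)) (φ ((y.shift μ).shift ν))) x)).trace).re ≤ a * (3 * P.d * M + 4 * K) :=
    (Finset.sum_le_sum fun x _ => Finset.sum_le_sum fun μ _ => Finset.sum_le_sum fun ν _ => le_abs_self _).trans hcp
  -- assemble: `K ≤ θ/2·M + CUR/(2θ) + a(3dM + 4K)`
  have hKle : K ≤ θ / 2 * M + θ⁻¹ / 2 * CUR + a * (3 * P.d * M + 4 * K) := by
    calc K = _ := hid
      _ ≤ _ := add_le_add hcurAM hcvb
  clear hid hid0 hcp hcurAM hcvb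
  -- substitute the current row: `CUR ≤ (C_J K + C′a²M)/w`
  have hCURle : CUR ≤ (C_J * K + C' * a ^ 2 * M) / w := by
    rw [le_div_iff₀ hw]; linarith only [hJ]
  have hθinv : θ⁻¹ / 2 * ((C_J * K + C' * a ^ 2 * M) / w) = K / 4 + C' * a ^ 2 / (4 * C_J) * M := by
    rw [hθ]
    field_simp
    ring
  have h1 : K ≤ θ / 2 * M + (K / 4 + C' * a ^ 2 / (4 * C_J) * M) + a * (3 * P.d * M + 4 * K) := by
    have := mul_le_mul_of_nonneg_left hCURle (by positivity : (0 : ℝ) ≤ θ⁻¹ / 2)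
    rw [hθinv] at this
    linarith only [hKle, this]
  -- absorb `K/4 + 4aK ≤ K/2`
  have h4a : 4 * a * K ≤ K / 4 := by nlinarith only [hK0, ha16, ha0]
  have hθM : θ / 2 * M = C_J / w * M := by rw [hθ]; ring
  have h2 : K / 2 ≤ C_J / w * M + C' * a ^ 2 / (4 * C_J) * M + 3 * P.d * a * M := by
    have e1 : a * (3 * P.d * M + 4 * K) = 3 * P.d * a * M + 4 * a * K := by ring
    rw [e1] at h1
    linarith only [h1, h4a, hθM]
  -- multiply by `2w`
  have h3 : w * K ≤ 2 * w * (C_J / w * M + C' * a ^ 2 / (4 * C_J) * M + 3 * P.d * a * M) := by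
    have := mul_le_mul_of_nonneg_left h2 (by positivity : (0 : ℝ) ≤ 2 * w)
    have e2 : 2 * w * (K / 2) = w * K := by ring
    linarith only [this, e2]
  have e : 2 * w * (C_J / w * M + C' * a ^ 2 / (4 * C_J) * M + 3 * P.d * a * M)
      = (2 * C_J + C' * a ^ 2 * w / (2 * C_J) + 6 * P.d * a * w) * M := by
    field_simp
    ring
  rw [e] at h3
  exact h3

end Summit.QuantumFields.YangMills.Theorems.Prop7RRowOfJRow

end
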